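/-
Copyright (c) 2026 the pub-hodgecm-mathlib formalisation cell (harness21).  Prover seat hodgecm-mathlib-F0P3-p01 (g31), «(D-RAM) FOUR-FRAME» road of crux H413, line LH4, MS ROAD A,
STAGE B ∕ B56₂ (G-socket₂ assembly, dealer WORD #26 (2)), FILE M: THE RE-KEYED SOCKET `stub_B56_G1` OF SKELETON₂ v2 MODULO THE POLARISATION COUNT — `Σ n₂·w = n₂(ρ) × FILE W`.
2026-09-04.
-/
import Summits.HodgeConjecture.HodgeConjecture.Theorems.F0P3cDyRamDiagonalGluedSocketTwoWeight   -- ★ FILE W (this seat): the plain-weight masses; brings ★ F1₂, ★ StrataDefs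
import HarnessLib

/-!
# Crux `H413`, MS ROAD A, STAGE B ∕ B56₂, FILE M: `Σᶠ_{M ∈ stratumTwo (2ρ+1, 2ρ+1+s, 2ρ+1+s)} n₂(M)·w(M)` = skeleton₂'s `(q−1)q^{2ρ+s∕2} + q^{2ρ+1+s∕2−⌈(2ρ+1−n₂)∕2⌉}`, GIVEN the per-stratum count

Cell `hodgecm-mathlib` (D-0151), FLOOR 0, crux item H413 = `stmt-HodgeConjecture-24833`; lane `--supports stmt-HodgeConjecture-24833 --as helper` (count-neutral).  THEOREMS ONLY
(no `def`, no instance, no notation, no `sorry`).  LH4-p10 (g2)'s re-keyed Stage B₂ socket (reading (iii), heir LEAD R-21; `polarisationCount` = ★ StrataDefs ED. 3, LH4-p11 (g2)):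
`∑ᶠ M ∈ stratumTwo σ ϖ T ![2ρ+1, 2ρ+1+s, 2ρ+1+s], (polarisationCount σ ϖ 2 M : ℚ) * stabiliserWeight σ M = ‹skeleton₂ 08e5e6e2 :81 RHS verbatim›`.  This file proves it from ONE
named input, the PER-STRATUM VALUE of the polarisation count (LH4-p08 (g3)'s (P1)–(P4); LH4-p09 (g2) 00:42:58Z, REF5 R5-75∕78, LH4-r01 (g3) DV∕DX tables, LH4-p10 (7,5,5)∕(3,3,3) runs):
`n₂(M) = q − 1` on the root-glued stratum (`ρ = 0`) and `n₂(M) = q^{1 − ρ % 2}` on the glued strata (`ρ ≥ 1`: `q` for even `ρ`, `1` for odd `ρ`), as the hypothesis `hmult`; the rest is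
★ FILE W (`Σ w` in closed form) and exponent bookkeeping: `q^{1−ρ%2}·(q−1)q^{2ρ+t−1+ρ%2} = (q−1)q^{2ρ+t}`, `q^{1−ρ%2}·q^{ρ+t+(m+1)∕2−1+ρ%2} = q^{2ρ+1+t−⌈(2ρ+1−m)∕2⌉}` (`ρ+1 ≤ m ≤ 2ρ`),
`(q−1)·q^{t}` at `ρ = 0` (glue clause void: `n₂ ≥ N₀ ≥ d ≥ 1`).
HEADS: `finsum_mul_stabiliserWeight_eq_mul_finsum` (constant factor out of a `finsum`, no finiteness needed over `ℚ`);
**`finsum_polarisationCount_mul_stabiliserWeight_stratumTwo_G1_of_mult`** = `stub_B56_G1` of skeleton₂ v2 with the extra binder `hmult`.  The binder-free socket is the one-liner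
`… := finsum_polarisationCount_mul_stabiliserWeight_stratumTwo_G1_of_mult hD h2 hE hN₀ hT ρ s hs (p08's ★ value lemma)` (FILE S, on LH4-p08 (g3)'s ★).
HONEST LABEL.  Count-neutral (`--supports`); conditional on the named multiplicity input until FILE S; the census laws (MS) stay PROVER TARGETS; `HC_CM` is proved only modulo the
7 printed citations (2 remaining named inputs: hLiu418 = `stmt-HodgeConjecture-24832`, h413 = `stmt-HodgeConjecture-24833`) until rung 0 closes.

## References
* [Kottwitz1986BaseChangeUnits] R. E. Kottwitz, *Base change for unit elements of Hecke algebras*, Compositio Math. 60 (1986), §1 pp. 240–241 (fixed-lattice counts via torus orbits).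
* [Rogawski1990] J. D. Rogawski, *Automorphic Representations of Unitary Groups in Three Variables*, Ann. of Math. Stud. 123 (1990), §4.9 Prop. 4.9.1 (a) p. 55.
-/

set_option autoImplicit false

noncomputable section

namespace Summit.HodgeConjecture.HodgeConjecture.Cruxes.H413.F0P3cDyRamDiagonalGluedSocketTwo

open Matrix
open Literature.NumberTheory.Automorphic Literature.NumberTheory.Automorphic.HermitianLattice
open Literature.NumberTheory.Automorphic.UnitaryLatticeTree Literature.NumberTheory.Automorphic.UnitaryThreeFourFrame
open Summit.HodgeConjecture.HodgeConjecture.Cruxes.H413.F0P3cDyRamDiagonalTorusDefs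
open Summit.HodgeConjecture.HodgeConjecture.Cruxes.H413.F0P3cDyRamDiagonalStrataDefs
open Summit.HodgeConjecture.HodgeConjecture.Cruxes.H413.F0P3cDyRamDiagonalGluedSocketTwoWeight
open scoped Valued WithZero Matrix MatrixGroups

section Factor

variable {K : Type*} [Field K] [Valued K ℤᵐ⁰] {N : ℕ}

/-- **A CONSTANT FACTOR COMES OUT OF THE WEIGHTED SUM** (over `ℚ` no finiteness is needed: `mul_finsum_mem`): if `m(M) = c` on `S` then `Σᶠ_{M ∈ S} m(M)·w(M) = c · Σᶠ_{M ∈ S} w(M)`.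
[cite: Kottwitz1986BaseChangeUnits, §1 pp. 240–241] -/
theorem finsum_mul_stabiliserWeight_eq_mul_finsum (σ : K →+* K) {S : Set (Submodule 𝒪[K] (Fin N → K))} {m : Submodule 𝒪[K] (Fin N → K) → ℚ} {c : ℚ}
    (hc : ∀ M ∈ S, m M = c) :
    ∑ᶠ M ∈ S, m M * stabiliserWeight σ M = c * ∑ᶠ M ∈ S, stabiliserWeight σ M := by
  rw [mul_finsum_mem]
  exact finsum_mem_congr rfl fun M hM => by rw [hc M hM]

end Factor

section Socket

variable {K : Type} [Field K] [Valued K ℤᵐ⁰] [Fintype 𝓀[K]] {σ : K →+* K} {ϖ : K} {d t : ℕ} {α β : K} {N₀ n₁ n₂ n₃ : ℕ} {T : GL (Fin 3) K}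

/-- Exponent bookkeeping on the type-2 glue regime: `(1 − ρ%2) + (ρ + t + (m+1)∕2 − 1 + ρ%2) = 2ρ+1+t − (2ρ+1−m+1)∕2` for `ρ+1 ≤ m ≤ 2ρ`. [cite: Kottwitz1986BaseChangeUnits, §1 pp. 240–241] -/
theorem glue_exponent_typeTwo {ρ t m : ℕ} (hρm : ρ + 1 ≤ m) (hm : m < 2 * ρ + 1) :
    (1 - ρ % 2) + (ρ + t + (m + 1) / 2 - 1 + ρ % 2) = 2 * ρ + 1 + t - (2 * ρ + 1 - m + 1) / 2 := by
  omega

/-- **SOCKET `stub_B56_G1` OF SKELETON₂ v2 MODULO THE POLARISATION COUNT** — glued ∕ root-glued type-2 strata, axis `(2ρ+1, 2ρ+1+s, 2ρ+1+s)`, `ρ ≥ 0`, `s ≥ 1`: GIVEN `hmult` (the count is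
the per-stratum constant `q − 1` at `ρ = 0`, `q^{1−ρ%2}` at `ρ ≥ 1` — LH4-p08 (g3)'s value lemma), the re-keyed mass is TUBE `(q−1)q^{2ρ+s∕2}` iff `s` even, `2ρ+1 ≤ min(n₂,n₃)`,
`2ρ+1+s ≤ n₁`, plus GLUE `q^{2ρ+1+s∕2−⌈(2ρ+1−n₂)∕2⌉}` iff `s` even, `n₂ = n₃`, `n₁ = n₂+s`, `n₂ < 2ρ+1 ≤ 2n₂`, `2ρ+1−n₂ ≤ n₂−d+1` (skeleton₂ 08e5e6e2 :81 RHS VERBATIM).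
[cite: Kottwitz1986BaseChangeUnits, §1 pp. 240–241] [cite: Rogawski1990, §4.9 Prop. 4.9.1 (a) p. 55] -/
theorem finsum_polarisationCount_mul_stabiliserWeight_stratumTwo_G1_of_mult (hD : IsRamifiedQuadraticDatum σ ϖ d t) (h2 : Valued.v (2 : K) < 1)
    (hE : IsElementDatum σ ϖ N₀ α β n₁ n₂ n₃) (hN₀ : d ≤ N₀) (hT : (T : Matrix (Fin 3) (Fin 3) K) = Matrix.diagonal ![α, β, 1]) (ρ s : ℕ) (hs : 1 ≤ s)
    (hmult : ∀ M ∈ stratumTwo σ ϖ T ![2 * ρ + 1, 2 * ρ + 1 + s, 2 * ρ + 1 + s],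
      (polarisationCount σ ϖ 2 M : ℚ) = if ρ = 0 then (Fintype.card 𝓀[K] : ℚ) - 1 else (Fintype.card 𝓀[K] : ℚ) ^ (1 - ρ % 2)) :
    ∑ᶠ M ∈ stratumTwo σ ϖ T ![2 * ρ + 1, 2 * ρ + 1 + s, 2 * ρ + 1 + s], (polarisationCount σ ϖ 2 M : ℚ) * stabiliserWeight σ M =
      (if 2 ∣ s ∧ 2 * ρ + 1 ≤ min n₂ n₃ ∧ 2 * ρ + 1 + s ≤ n₁ then (((Fintype.card 𝓀[K] : ℚ) - 1) * (Fintype.card 𝓀[K] : ℚ) ^ (2 * ρ + s / 2)) else 0) +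
      (if 2 ∣ s ∧ n₂ = n₃ ∧ n₁ = n₂ + s ∧ n₂ < 2 * ρ + 1 ∧ 2 * ρ + 1 ≤ 2 * n₂ ∧ 2 * ρ + 1 - n₂ ≤ n₂ - d + 1
        then ((Fintype.card 𝓀[K] : ℚ) ^ (2 * ρ + 1 + s / 2 - (2 * ρ + 1 - n₂ + 1) / 2)) else 0) := by
  rw [finsum_mul_stabiliserWeight_eq_mul_finsum σ hmult]
  set q : ℚ := (Fintype.card 𝓀[K] : ℚ) with hq
  rcases Nat.eq_zero_or_pos ρ with rfl | hρ
  · -- ρ = 0: the root-glued stratum, `n₂ = q − 1`; the glue clause is void (`n₂ ≥ N₀ ≥ d ≥ 1`)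
    have h1d : 1 ≤ d := hD.2.2.2.2.2.1
    have hn : N₀ ≤ n₁ ∧ N₀ ≤ n₂ ∧ N₀ ≤ n₃ := ⟨hE.2.2.2.2.2.2.2.2.1, hE.2.2.2.2.2.2.2.2.2.1, hE.2.2.2.2.2.2.2.2.2.2⟩
    rw [if_pos rfl, finsum_stabiliserWeight_stratumTwo_G1_zero hD hE hN₀ hT s hs]
    have hglue : ¬ (2 ∣ s ∧ n₂ = n₃ ∧ n₁ = n₂ + s ∧ n₂ < 2 * 0 + 1 ∧ 2 * 0 + 1 ≤ 2 * n₂ ∧ 2 * 0 + 1 - n₂ ≤ n₂ - d + 1) := fun h => by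
      have := h.2.2.2.2.1; omega
    rw [if_neg hglue, add_zero]
    by_cases h : 2 ∣ s ∧ 1 + s ≤ n₁
    · have h' : 2 ∣ s ∧ 2 * 0 + 1 ≤ min n₂ n₃ ∧ 2 * 0 + 1 + s ≤ n₁ := ⟨h.1, le_min (by omega) (by omega), by omega⟩
      rw [if_pos h, if_pos h']
      congr 2; omega
    · have h' : ¬ (2 ∣ s ∧ 2 * 0 + 1 ≤ min n₂ n₃ ∧ 2 * 0 + 1 + s ≤ n₁) := fun h' => h ⟨h'.1, by omega⟩
      rw [if_neg h, if_neg h', mul_zero]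
  · -- ρ ≥ 1: the glued strata, `n₂ = q^{1 − ρ%2}`
    rw [if_neg (by omega), finsum_stabiliserWeight_stratumTwo_G1 hD h2 hE hN₀ hT ρ s hρ hs, mul_add]
    congr 1
    · by_cases h : 2 ∣ s ∧ 2 * ρ + 1 ≤ min n₂ n₃ ∧ 2 * ρ + 1 + s ≤ n₁
      · rw [if_pos h, if_pos h, mul_left_comm, ← pow_add]
        congr 2; omega
      · rw [if_neg h, if_neg h, mul_zero]
    · by_cases h : 2 ∣ s ∧ n₂ = n₃ ∧ n₁ = n₂ + s ∧ n₂ < 2 * ρ + 1 ∧ 2 * ρ + 1 ≤ 2 * n₂ ∧ 2 * ρ + 1 - n₂ ≤ n₂ - d + 1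
      · rw [if_pos h, if_pos h, ← pow_add]
        congr 1
        have := glue_exponent_typeTwo (t := s / 2) (by omega : ρ + 1 ≤ n₂) h.2.2.2.1
        omega
      · rw [if_neg h, if_neg h, mul_zero]

end Socket

end Summit.HodgeConjecture.HodgeConjecture.Cruxes.H413.F0P3cDyRamDiagonalGluedSocketTwo

end
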